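import Mathlib
import HarnessLib
import Summits.Ventures.LatticeQCDFlow.Scaling.AutoregressiveGaugeKLExtensiveAllPlanesLogWeight

/-!
# LatticeQCDFlow / Scaling — THE LOGARITHMIC VOLUME LAW AT THE OPTIMAL WEIGHT: per counted link
# `u·log(u/Haar B) + (1 − u)·log(1 − u) = u·log(1/Haar B) − h(u)` for every mass floor `u ≤ π_β{U_p ∈ B}`,
# and its Chebyshev instance `u = 1 − 2N(1 − w)/ε²`

HONEST FRAMING: exact (Metropolis-corrected) sampling algorithms for lattice gauge theory;
figures of merit are autocorrelation/cost numbers at stated couplings and volumes; no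
continuum-physics claim.

Venture `LatticeQCDFlow` (cell pub-lqcd), topic `Scaling`, FANOUT row 30 (lean-1, GEN-22) — OUR WORK on
THEORY-2.md §4 row C5: the weight of `Scaling/AutoregressiveGaugeKLExtensiveAllPlanesLogWeight` set equal
to a mass floor.  For `½ ≤ u < 1` with `u ≤ π_β{U_p ∈ B} = Y_p/Z` at every plaquette, the affine function
`y ↦ y·log(u/Haar B) + (1 − y)·log(1 − u)` has slope `log(u/(Haar B·(1 − u))) ≥ 0` (`Haar B ≤ 1`,
`1 − u ≤ u`), so its value at `Y_p/Z` is at least its value at `u`: the rate per counted link is the binary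
relative entropy `D(u ‖ Haar B) ≥ u·log(u/Haar B) + (1 − u)·log(1 − u) = u·log(1/Haar B) − h(u)`,
`h(u) = −u·log u − (1 − u)·log(1 − u) ≤ log 2` — replacing the half-weight rate
`π_β(B)·log(1/Haar B) − log 2` whose Chebyshev instance carried the factor `½`.

## What is proved (all [ours]; continuous `ρ`, `d ≥ 2`, `L ≥ 2`, any real `β`; `B ⊆ G` measurable with
`Haar(B) > 0`; `½ ≤ u < 1`; squeezed normalised conditionals `q_a` not reading later links of a
duplicate-free order `l` of ALL links, each `q_e` blind to the other links at an endpoint `Y e` of `e`)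

* §1 **`binaryRate_le_of_mass_le`** — the monotonicity step: `u ≤ y`, `0 < Haar B ≤ 1` ⇒
  `u·log(u/Haar B) + (1 − u)·log(1 − u) ≤ y·log(u/Haar B) + (1 − y)·log(1 − u)`.
* §2 **`wilson_kl_arHybrid_ge_dim_mul_card_site_mul_ballLog_of_mass`** — `u ≤ Y_p/Z` at every plaquette,
  `0 ≤ u·log(u/Haar B) + (1 − u)·log(1 − u)` ⇒
  `(d·#sites/4)·(u·log(u/Haar B) + (1 − u)·log(1 − u)) ≤ KL(e^{−βS_W}/Z ‖ H_l)`;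
  **`wilson_tauInt_sign_ge_exp_ballLog_of_mass`** — `exp(the same) − ½ ≤ τ_int(g)` for every measurable
  balanced sign observable `g` of the exact sampler.
* §3 **`wilson_kl_arHybrid_ge_dim_mul_card_site_mul_ballLog_of_floor_mass`**,
  **`wilson_tauInt_sign_ge_exp_ballLog_of_floor_mass`** (unitary `ρ`, `N ≥ 1`, `ε > 0`,
  `B = B_ε = {‖ρ(g) − 1‖ ≤ ε}`, `φ_ρ(ε) = Haar B_ε > 0`) — with `u = 1 − 2N(1 − w)/ε²` from a common
  plaquette floor `w ≤ ⟨(1/N)Re tr U_p⟩_β`, `4N(1 − w) ≤ ε²` (so `u ≥ ½`) and `w < 1`: the same two laws.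

READING (value-free): `ε² = 2N(1 − w)·t` gives `u = 1 − 1/t` and a rate
`(1 − 1/t)·log(1/φ_ρ(ε)) + (1 − 1/t)·log(1 − 1/t) − (log t)/t`, i.e. the full small-ball surprisal up to
`1/t`-corrections; group-specific inputs (`SU(2)`, `SU(3)`) are separate files.  NOT CLAIMED: conditioners
reading both endpoints.  No `def`, no `sorry`, nothing cited as a fact beyond the tree.
-/

noncomputable section

namespace Summit.Ventures.LatticeQCDFlow.Theory2.Autoregressive

open MeasureTheory Function Set
open Literature.MathematicalPhysics.QuantumFieldTheory Literature.MathematicalPhysics.QuantumLattice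
open Summit.Ventures.LatticeQCDFlow.Exactness Summit.Ventures.LatticeQCDFlow.Scoring
open scoped Matrix Matrix.Norms.Frobenius

/-! ## §1 The optimal-weight rate is monotone in the mass -/

/-- **Monotonicity of the affine weight functional.**  `0 < φ ≤ 1`, `½ ≤ u < 1`, `u ≤ y` ⇒
`u·log(u/φ) + (1 − u)·log(1 − u) ≤ y·log(u/φ) + (1 − y)·log(1 − u)` (slope `log(u/(φ(1 − u))) ≥ 0`). [ours] -/
theorem binaryRate_le_of_mass_le {φ u y : ℝ} (hφ0 : 0 < φ) (hφ1 : φ ≤ 1) (hu : 1 / 2 ≤ u) (hu1 : u < 1)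
    (huy : u ≤ y) :
    u * Real.log (u / φ) + (1 - u) * Real.log (1 - u) ≤ y * Real.log (u / φ) + (1 - y) * Real.log (1 - u) := by
  have hupos : 0 < u := by linarith
  -- `1 − u ≤ u ≤ u/φ`
  have h1 : 1 - u ≤ u / φ := by
    have : u ≤ u / φ := by
      rw [le_div_iff₀ hφ0]
      nlinarith
    linarith
  have hslope : Real.log (1 - u) ≤ Real.log (u / φ) := Real.log_le_log (by linarith) h1
  nlinarith [hslope, huy]

section Wilson

variable {d L N : ℕ} {G : Type*} [Group G] [TopologicalSpace G] [IsTopologicalGroup G]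
  [CompactSpace G] [SecondCountableTopology G] [MeasurableSpace G] [BorelSpace G] [NeZero L]
  (ρ : G →* Matrix (Fin N) (Fin N) ℂ)

/-! ## §2 The volume law at the optimal weight -/

/-- **THE VOLUME LAW FOR THE TRAINING LOSS AT THE OPTIMAL WEIGHT.**  `d ≥ 2`, `L ≥ 2`, continuous `ρ`, any
`β`; `B ⊆ G` measurable with `Haar(B) > 0`; a common mass floor `½ ≤ u < 1`, `u ≤ (1/Z)∫𝟙_B(U_p)F dπ` at
every plaquette, with `0 ≤ u·log(u/Haar B) + (1 − u)·log(1 − u)`; squeezed normalised conditionals along a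
duplicate-free order `l` of ALL links, not reading later links, each `q_e` blind to the other links at an
endpoint `Y e` of `e`.  Then `(d·#sites/4)·(u·log(u/Haar B) + (1 − u)·log(1 − u)) ≤ KL(e^{−βS_W}/Z ‖ H_l)`.
[ours] -/
theorem wilson_kl_arHybrid_ge_dim_mul_card_site_mul_ballLog_of_mass (hd : 2 ≤ d) (hρ : Continuous ρ)
    (hL : 2 ≤ L) (β : ℝ) {B : Set G} (hBm : MeasurableSet B) (hB0 : 0 < (haarProbability G).real B)
    {u : ℝ} (hu : 1 / 2 ≤ u) (hu1 : u < 1)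
    (huB : ∀ p : Plaquette d L, u ≤
        (∫ U, B.indicator (1 : G → ℝ) (plaquetteHolonomy U p.1 p.2.1.1 p.2.1.2) *
            Real.exp (-β * wilsonAction ρ U) ∂Measure.pi (fun _ : Edge d L => haarProbability G)) /
          (∫ W, Real.exp (-β * wilsonAction ρ W) ∂Measure.pi (fun _ : Edge d L => haarProbability G)))
    (hm0 : 0 ≤ u * Real.log (u / (haarProbability G).real B) + (1 - u) * Real.log (1 - u))
    {q : Edge d L → GaugeConfig d L G → ℝ} (hqm : ∀ a, Measurable (q a)) {cq Cq : ℝ} (hcq : 0 < cq)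
    (hqlo : ∀ a U, cq ≤ q a U) (hqhi : ∀ a U, q a U ≤ Cq)
    (hq1 : ∀ a U, ∫ v, q a (update U a v) ∂(haarProbability G) = 1)
    (l : List (Edge d L)) (hl : l.Nodup) (hall : ∀ e : Edge d L, e ∈ l)
    (hpw : l.Pairwise (fun a b => ∀ (U : GaugeConfig d L G) (v : G), q a (update U b v) = q a U))
    (Y : Edge d L → Site d L) (hY : ∀ e : Edge d L, e.1 = Y e ∨ e.1.shift e.2 = Y e)
    (hqB : ∀ e e' : Edge d L, e'.1 = Y e ∨ e'.1.shift e'.2 = Y e → e' ≠ e →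
      ∀ (U : GaugeConfig d L G) (v : G), q e (update U e' v) = q e U) :
    (d : ℝ) * Fintype.card (Site d L) / 4 *
        (u * Real.log (u / (haarProbability G).real B) + (1 - u) * Real.log (1 - u)) ≤
      ∫ U, Real.exp (-β * wilsonAction ρ U) /
            (∫ W, Real.exp (-β * wilsonAction ρ W) ∂Measure.pi (fun _ : Edge d L => haarProbability G)) *
          Real.log ((Real.exp (-β * wilsonAction ρ U) /
              ∫ W, Real.exp (-β * wilsonAction ρ W) ∂Measure.pi (fun _ : Edge d L => haarProbability G)) /
            ((l.map fun b => q b U).prod *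
                coordAvg (haarProbability G) l.toFinset
                  (fun V : GaugeConfig d L G => Real.exp (-β * wilsonAction ρ V)) U /
              ∫ W, Real.exp (-β * wilsonAction ρ W) ∂Measure.pi (fun _ : Edge d L => haarProbability G)))
        ∂Measure.pi (fun _ : Edge d L => haarProbability G) := by
  have hφ1 : (haarProbability G).real B ≤ 1 := measureReal_le_one
  exact wilson_kl_arHybrid_ge_dim_mul_card_site_mul_ballLogWeight (d := d) (L := L) ρ hd hρ hL β hBm hB0
    (a := u) (by linarith) hu1 hm0
    (fun p => binaryRate_le_of_mass_le hB0 hφ1 hu hu1 (huB p))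
    hqm hcq hqlo hqhi hq1 l hl hall hpw Y hY hqB

/-- **`τ_int(g) ≥ exp((d·#sites/4)·(u·log(u/Haar B) + (1 − u)·log(1 − u))) − ½`** for every measurable
balanced sign observable `g` of the exact independence sampler, under the hypotheses of
`wilson_kl_arHybrid_ge_dim_mul_card_site_mul_ballLog_of_mass`. [ours] -/
theorem wilson_tauInt_sign_ge_exp_ballLog_of_mass (hd : 2 ≤ d) (hρ : Continuous ρ)
    (hL : 2 ≤ L) (β : ℝ) {B : Set G} (hBm : MeasurableSet B) (hB0 : 0 < (haarProbability G).real B)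
    {u : ℝ} (hu : 1 / 2 ≤ u) (hu1 : u < 1)
    (huB : ∀ p : Plaquette d L, u ≤
        (∫ U, B.indicator (1 : G → ℝ) (plaquetteHolonomy U p.1 p.2.1.1 p.2.1.2) *
            Real.exp (-β * wilsonAction ρ U) ∂Measure.pi (fun _ : Edge d L => haarProbability G)) /
          (∫ W, Real.exp (-β * wilsonAction ρ W) ∂Measure.pi (fun _ : Edge d L => haarProbability G)))
    (hm0 : 0 ≤ u * Real.log (u / (haarProbability G).real B) + (1 - u) * Real.log (1 - u))
    {q : Edge d L → GaugeConfig d L G → ℝ} (hqm : ∀ a, Measurable (q a)) {cq Cq : ℝ} (hcq : 0 < cq)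
    (hqlo : ∀ a U, cq ≤ q a U) (hqhi : ∀ a U, q a U ≤ Cq)
    (hq1 : ∀ a U, ∫ v, q a (update U a v) ∂(haarProbability G) = 1)
    (l : List (Edge d L)) (hl : l.Nodup) (hall : ∀ e : Edge d L, e ∈ l)
    (hpw : l.Pairwise (fun a b => ∀ (U : GaugeConfig d L G) (v : G), q a (update U b v) = q a U))
    (Y : Edge d L → Site d L) (hY : ∀ e : Edge d L, e.1 = Y e ∨ e.1.shift e.2 = Y e)
    (hqB : ∀ e e' : Edge d L, e'.1 = Y e ∨ e'.1.shift e'.2 = Y e → e' ≠ e →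
      ∀ (U : GaugeConfig d L G) (v : G), q e (update U e' v) = q e U)
    {g : GaugeConfig d L G → ℝ} (hgm : Measurable g) (hg1 : ∀ U, g U ^ 2 = 1)
    (hg0 : ∫ U, g U * Real.exp (-β * wilsonAction ρ U) ∂Measure.pi (fun _ : Edge d L => haarProbability G) = 0) :
    Real.exp ((d : ℝ) * Fintype.card (Site d L) / 4 *
        (u * Real.log (u / (haarProbability G).real B) + (1 - u) * Real.log (1 - u))) - 1 / 2 ≤
      tauInt (fun k => (∫ U, g U * ((imhOp (Measure.pi fun _ : Edge d L => haarProbability G)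
          (fun V : GaugeConfig d L G => Real.exp (-β * wilsonAction ρ V))
          (fun V : GaugeConfig d L G => (l.map fun b => q b V).prod *
              coordAvg (haarProbability G) l.toFinset
                (fun V' : GaugeConfig d L G => Real.exp (-β * wilsonAction ρ V')) V /
            ∫ W, Real.exp (-β * wilsonAction ρ W) ∂Measure.pi (fun _ : Edge d L => haarProbability G)))^[k]
            g) U * Real.exp (-β * wilsonAction ρ U) ∂Measure.pi (fun _ : Edge d L => haarProbability G)) /
          ∫ U, g U ^ 2 * Real.exp (-β * wilsonAction ρ U) ∂Measure.pi (fun _ : Edge d L => haarProbability G)) := by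
  have hφ1 : (haarProbability G).real B ≤ 1 := measureReal_le_one
  exact wilson_tauInt_sign_ge_exp_ballLogWeight (d := d) (L := L) ρ hd hρ hL β hBm hB0
    (a := u) (by linarith) hu1 hm0
    (fun p => binaryRate_le_of_mass_le hB0 hφ1 hu hu1 (huB p))
    hqm hcq hqlo hqhi hq1 l hl hall hpw Y hY hqB hgm hg1 hg0

/-! ## §3 From a plaquette floor, by Chebyshev -/

/-- **The optimal-weight logarithmic volume law from a plaquette floor** (unitary `ρ`, `N ≥ 1`, `ε > 0`):
with `w ≤ ⟨(1/N)Re tr U_p⟩_β` for every plaquette, `w < 1`, `4N(1 − w) ≤ ε²` and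
`u = 1 − 2N(1 − w)/ε²` (so `½ ≤ u < 1`), `φ_ρ(ε) = Haar{‖ρ(g) − 1‖ ≤ ε} > 0` and
`0 ≤ u·log(u/φ_ρ(ε)) + (1 − u)·log(1 − u)`:
`(d·#sites/4)·(u·log(u/φ_ρ(ε)) + (1 − u)·log(1 − u)) ≤ KL(e^{−βS_W}/Z ‖ H_l)`. [ours] -/
theorem wilson_kl_arHybrid_ge_dim_mul_card_site_mul_ballLog_of_floor_mass (hd : 2 ≤ d) (hN : 1 ≤ N)
    (hρ : Continuous ρ) (hρU : ∀ g, ρ g ∈ Matrix.unitaryGroup (Fin N) ℂ) (hL : 2 ≤ L) (β : ℝ)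
    {ε : ℝ} (hε : 0 < ε) (hφ0 : 0 < (haarProbability G).real {g : G | ‖ρ g - 1‖ ≤ ε}) {w : ℝ}
    (hw : ∀ p : Plaquette d L, w ≤ wilsonExpectation ρ β
      (fun U : GaugeConfig d L G => (N : ℝ)⁻¹ * (ρ (plaquetteHolonomy U p.1 p.2.1.1 p.2.1.2)).trace.re))
    (hw1 : w < 1) (hwε : 4 * N * (1 - w) ≤ ε ^ 2)
    (hm0 : 0 ≤ (1 - 2 * N * (1 - w) / ε ^ 2) *
        Real.log ((1 - 2 * N * (1 - w) / ε ^ 2) / (haarProbability G).real {g : G | ‖ρ g - 1‖ ≤ ε}) +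
      (1 - (1 - 2 * N * (1 - w) / ε ^ 2)) * Real.log (1 - (1 - 2 * N * (1 - w) / ε ^ 2)))
    {q : Edge d L → GaugeConfig d L G → ℝ} (hqm : ∀ a, Measurable (q a)) {cq Cq : ℝ} (hcq : 0 < cq)
    (hqlo : ∀ a U, cq ≤ q a U) (hqhi : ∀ a U, q a U ≤ Cq)
    (hq1 : ∀ a U, ∫ v, q a (update U a v) ∂(haarProbability G) = 1)
    (l : List (Edge d L)) (hl : l.Nodup) (hall : ∀ e : Edge d L, e ∈ l)
    (hpw : l.Pairwise (fun a b => ∀ (U : GaugeConfig d L G) (v : G), q a (update U b v) = q a U))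
    (Y : Edge d L → Site d L) (hY : ∀ e : Edge d L, e.1 = Y e ∨ e.1.shift e.2 = Y e)
    (hqB : ∀ e e' : Edge d L, e'.1 = Y e ∨ e'.1.shift e'.2 = Y e → e' ≠ e →
      ∀ (U : GaugeConfig d L G) (v : G), q e (update U e' v) = q e U) :
    (d : ℝ) * Fintype.card (Site d L) / 4 *
        ((1 - 2 * N * (1 - w) / ε ^ 2) *
            Real.log ((1 - 2 * N * (1 - w) / ε ^ 2) / (haarProbability G).real {g : G | ‖ρ g - 1‖ ≤ ε}) +
          (1 - (1 - 2 * N * (1 - w) / ε ^ 2)) * Real.log (1 - (1 - 2 * N * (1 - w) / ε ^ 2))) ≤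
      ∫ U, Real.exp (-β * wilsonAction ρ U) /
            (∫ W, Real.exp (-β * wilsonAction ρ W) ∂Measure.pi (fun _ : Edge d L => haarProbability G)) *
          Real.log ((Real.exp (-β * wilsonAction ρ U) /
              ∫ W, Real.exp (-β * wilsonAction ρ W) ∂Measure.pi (fun _ : Edge d L => haarProbability G)) /
            ((l.map fun b => q b U).prod *
                coordAvg (haarProbability G) l.toFinset
                  (fun V : GaugeConfig d L G => Real.exp (-β * wilsonAction ρ V)) U /
              ∫ W, Real.exp (-β * wilsonAction ρ W) ∂Measure.pi (fun _ : Edge d L => haarProbability G)))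
        ∂Measure.pi (fun _ : Edge d L => haarProbability G) := by
  have hBm : MeasurableSet {g : G | ‖ρ g - 1‖ ≤ ε} :=
    (isClosed_le ((hρ.sub continuous_const).norm) continuous_const).measurableSet
  have hε2 : 0 < ε ^ 2 := by positivity
  have hNpos : (0 : ℝ) < N := by exact_mod_cast hN
  -- `½ ≤ u < 1`
  have hu : 1 / 2 ≤ 1 - 2 * N * (1 - w) / ε ^ 2 := by
    have : 2 * N * (1 - w) / ε ^ 2 ≤ 1 / 2 := by
      rw [div_le_iff₀ hε2]; linarith
    linarith
  have hu1 : 1 - 2 * N * (1 - w) / ε ^ 2 < 1 := by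
    have : 0 < 2 * N * (1 - w) / ε ^ 2 := by
      apply div_pos _ hε2
      nlinarith
    linarith
  exact wilson_kl_arHybrid_ge_dim_mul_card_site_mul_ballLog_of_mass (d := d) (L := L) ρ hd hρ hL β hBm hφ0 hu
    hu1 (fun p => wilson_ball_mass_ge_of_floor (d := d) (L := L) ρ hN hρ hρU β hε p (hw p)) hm0
    hqm hcq hqlo hqhi hq1 l hl hall hpw Y hY hqB

/-- **`τ_int(g) ≥ exp((d·#sites/4)·(u·log(u/φ_ρ(ε)) + (1 − u)·log(1 − u))) − ½`**, `u = 1 − 2N(1 − w)/ε²`,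
for every measurable balanced sign observable `g` of the exact independence sampler, under the hypotheses of
`wilson_kl_arHybrid_ge_dim_mul_card_site_mul_ballLog_of_floor_mass`. [ours] -/
theorem wilson_tauInt_sign_ge_exp_ballLog_of_floor_mass (hd : 2 ≤ d) (hN : 1 ≤ N)
    (hρ : Continuous ρ) (hρU : ∀ g, ρ g ∈ Matrix.unitaryGroup (Fin N) ℂ) (hL : 2 ≤ L) (β : ℝ)
    {ε : ℝ} (hε : 0 < ε) (hφ0 : 0 < (haarProbability G).real {g : G | ‖ρ g - 1‖ ≤ ε}) {w : ℝ}
    (hw : ∀ p : Plaquette d L, w ≤ wilsonExpectation ρ β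
      (fun U : GaugeConfig d L G => (N : ℝ)⁻¹ * (ρ (plaquetteHolonomy U p.1 p.2.1.1 p.2.1.2)).trace.re))
    (hw1 : w < 1) (hwε : 4 * N * (1 - w) ≤ ε ^ 2)
    (hm0 : 0 ≤ (1 - 2 * N * (1 - w) / ε ^ 2) *
        Real.log ((1 - 2 * N * (1 - w) / ε ^ 2) / (haarProbability G).real {g : G | ‖ρ g - 1‖ ≤ ε}) +
      (1 - (1 - 2 * N * (1 - w) / ε ^ 2)) * Real.log (1 - (1 - 2 * N * (1 - w) / ε ^ 2)))
    {q : Edge d L → GaugeConfig d L G → ℝ} (hqm : ∀ a, Measurable (q a)) {cq Cq : ℝ} (hcq : 0 < cq)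
    (hqlo : ∀ a U, cq ≤ q a U) (hqhi : ∀ a U, q a U ≤ Cq)
    (hq1 : ∀ a U, ∫ v, q a (update U a v) ∂(haarProbability G) = 1)
    (l : List (Edge d L)) (hl : l.Nodup) (hall : ∀ e : Edge d L, e ∈ l)
    (hpw : l.Pairwise (fun a b => ∀ (U : GaugeConfig d L G) (v : G), q a (update U b v) = q a U))
    (Y : Edge d L → Site d L) (hY : ∀ e : Edge d L, e.1 = Y e ∨ e.1.shift e.2 = Y e)
    (hqB : ∀ e e' : Edge d L, e'.1 = Y e ∨ e'.1.shift e'.2 = Y e → e' ≠ e →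
      ∀ (U : GaugeConfig d L G) (v : G), q e (update U e' v) = q e U)
    {g : GaugeConfig d L G → ℝ} (hgm : Measurable g) (hg1 : ∀ U, g U ^ 2 = 1)
    (hg0 : ∫ U, g U * Real.exp (-β * wilsonAction ρ U) ∂Measure.pi (fun _ : Edge d L => haarProbability G) = 0) :
    Real.exp ((d : ℝ) * Fintype.card (Site d L) / 4 *
        ((1 - 2 * N * (1 - w) / ε ^ 2) *
            Real.log ((1 - 2 * N * (1 - w) / ε ^ 2) / (haarProbability G).real {g : G | ‖ρ g - 1‖ ≤ ε}) +
          (1 - (1 - 2 * N * (1 - w) / ε ^ 2)) * Real.log (1 - (1 - 2 * N * (1 - w) / ε ^ 2)))) - 1 / 2 ≤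
      tauInt (fun k => (∫ U, g U * ((imhOp (Measure.pi fun _ : Edge d L => haarProbability G)
          (fun V : GaugeConfig d L G => Real.exp (-β * wilsonAction ρ V))
          (fun V : GaugeConfig d L G => (l.map fun b => q b V).prod *
              coordAvg (haarProbability G) l.toFinset
                (fun V' : GaugeConfig d L G => Real.exp (-β * wilsonAction ρ V')) V /
            ∫ W, Real.exp (-β * wilsonAction ρ W) ∂Measure.pi (fun _ : Edge d L => haarProbability G)))^[k]
            g) U * Real.exp (-β * wilsonAction ρ U) ∂Measure.pi (fun _ : Edge d L => haarProbability G)) /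
          ∫ U, g U ^ 2 * Real.exp (-β * wilsonAction ρ U) ∂Measure.pi (fun _ : Edge d L => haarProbability G)) := by
  have hBm : MeasurableSet {g : G | ‖ρ g - 1‖ ≤ ε} :=
    (isClosed_le ((hρ.sub continuous_const).norm) continuous_const).measurableSet
  have hε2 : 0 < ε ^ 2 := by positivity
  have hNpos : (0 : ℝ) < N := by exact_mod_cast hN
  have hu : 1 / 2 ≤ 1 - 2 * N * (1 - w) / ε ^ 2 := by
    have : 2 * N * (1 - w) / ε ^ 2 ≤ 1 / 2 := by
      rw [div_le_iff₀ hε2]; linarith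
    linarith
  have hu1 : 1 - 2 * N * (1 - w) / ε ^ 2 < 1 := by
    have : 0 < 2 * N * (1 - w) / ε ^ 2 := by
      apply div_pos _ hε2
      nlinarith
    linarith
  exact wilson_tauInt_sign_ge_exp_ballLog_of_mass (d := d) (L := L) ρ hd hρ hL β hBm hφ0 hu hu1
    (fun p => wilson_ball_mass_ge_of_floor (d := d) (L := L) ρ hN hρ hρU β hε p (hw p)) hm0
    hqm hcq hqlo hqhi hq1 l hl hall hpw Y hY hqB hgm hg1 hg0

end Wilson

end Summit.Ventures.LatticeQCDFlow.Theory2.Autoregressive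

end
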